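import Summits.AtomisticToContinuum.Crystallization.Theses.ThreeConeCertificate
import Summits.AtomisticToContinuum.Crystallization.Theorems.SlackRigidity.Negative.WitnessBasics
import Summits.AtomisticToContinuum.Crystallization.Theorems.ThreeConeCertificateSlackRigidityRodDefs
import Summits.AtomisticToContinuum.Crystallization.Theorems.ThreeConeCertificateSlackRigidityRodProfile
import Summits.AtomisticToContinuum.Crystallization.Theorems.ThreeConeCertificateSlackRigidityRodSlice
import Summits.AtomisticToContinuum.Crystallization.Theorems.ThreeConeCertificateSlackRigidityRootingField
import Summits.AtomisticToContinuum.Crystallization.Theorems.ThreeConeCertificateSlackRigidityLocalLimitField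
import Summits.AtomisticToContinuum.Crystallization.Theorems.ThreeConeCertificateSlackRigidityLayerUnfolding
import Summits.AtomisticToContinuum.Crystallization.Theorems.ThreeConeCertificateSlackRigidityRodLemma
import Summits.AtomisticToContinuum.Crystallization.Theorems.ThreeConeCertificateSlackRigidityReduction
import Summits.AtomisticToContinuum.Crystallization.Theorems.ThreeConeCertificateSlackRigidityLayeringIdeal
import Literature.MathematicalPhysics.StatisticalMechanics.LennardJonesClusters
import Literature.MathematicalPhysics.StatisticalMechanics.LocalMatchingCompactness
import Literature.MathematicalPhysics.StatisticalMechanics.BarlowStacking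
import Mathlib.Analysis.Fourier.FourierTransform
import Mathlib.Analysis.SpecialFunctions.Complex.Log

/-!
# Line `signed-root-silent-field` — skeleton for the crux `ThreeConeCertificate.SlackRigidity`
(crux item stmt-AtomisticToContinuum-11960, rank 4, route `route-AtomisticToContinuum-ThreeConeCertificate`;
lead c2, RESHAPED from the planner's `Lines/signed-root-silent-field.lean` — same composition idea,
stubs cut along the seams of the LANDED `c-layer-witness-strictness` machinery)

Crux (FIXED, by name; `SlackRigidityNegative.slackRigidity_iff : SlackRigidity ↔ ∃ P, RigidFor P` is
`Iff.rfl`): there is ONE periodic `P` such that for every `(R, ε)`, along every injective sequence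
`x N : Fin N → ℝ³` with energy excess `o(N)`, all but `o(N)` particles have their `R`-environment
two-way `ε`-matched to `x i + A (P.points)` for some linear isometry `A`.

Idea (card `Ideas/signed-root-silent-field.md`): read the exact three-cone certificate
`V_LJ = g + U + f` of crux 11959 in LOCALISED form — `f = K ⋆ K` the convolution square of a radial
kernel (the SIGNED ROOT `𝓕K = ±√f̂`, continuous, `O(r⁻⁴)`), `g` certified by a one-centre star
functional `F ≥ 0`.  The total slack `E_N(x) − N e(P) = [Σ g + cN − Σ F] + Σ_i F(star_i) + Σ_{i<j} U
+ ½∫Φ_x²`, `Φ_x = Σ_j K(|· − x_j|)`, is a sum of LOCAL NONNEGATIVE densities, so an `o(N)`-excess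
sequence with a positive fraction of bad particles has bad roots of vanishing local slack in ALL
THREE channels; their local limit `Y ∋ 0` is `1/3`-separated, `F`-tight, `U`-tight and SILENT
(`Φ_Y ≡ 0`); the certificate's weak tight locus + the landed layering theorem make `Y` a linearly
rotated Barlow stacking; and a silent Barlow stacking is hcp, because on the torus sections
`x₃ = t` silence unfolds into the 1-D identities `Σ_k ω^{L_k} c_G(t − kh) = 0` for the class-1 dual
vector `G` (`ω = e^{−2πi/3}`, `L = haggLabel s`, `c_G = rodProfile a K`), whose kernel has 1-D
Fourier transform `𝓕K̃` restricted to the `(10)` rod (Fourier slice); if `𝓕K̃` does not vanish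
(and is C²) on the single Bragg-free shell `4/(3a²) + 1/(4h²) < |ξ|² < 4/(3a²) + 1/h²` (rod heights
`hξ₃ ∈ (1/2, 1)`), the bounded phase sequence `ω^{L_k}` has spectrum in `{0, 1/2} + ℤ`, hence is
`2`-periodic, hence `L_{k+2} ≡ L_k (3)`, the Hägg word alternates and the stacking is (rotated) hcp.

STATUS (lead c2, 2026-08-16 ~18:45Z): SIX of the seven stubs are LANDED and wired in below; the only `sorry`
left is `stub_certificate` (the open localised exact certificate ⊋ crux 11959).  The composition with the
certificate as HYPOTHESIS is landed as
`Theorems.SignedRootReduction.slackRigidity_of_localisedCertificate : LocalisedCertificate → SlackRigidity`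
(p120814, `ThreeConeCertificateSlackRigidityRodReduction.lean`): the crux is CLOSED MODULO `stub_certificate`.

THE LINE (7 registered stubs, glued by `SlackRigidity_of`, kernel-checked, no `sorry` of its own):
* `stub_certificate`     (S1, XL — the transfer `C⁺`; = crux 11959 STRENGTHENED, OPEN): `∃` a
  localised exact certificate (window, split, smearing `f = K ⋆ K`, star functional, exactness at
  `hcp(a,h)`, weak tight locus, single-shell selection clause).
* `stub_rootingField`    (S3a, M — `CLayerWitnessRooting.stub_rooting` + the field channel): rooted
  small-slack bad sequence, smallness in the THREE channels `F`, `U`, `∫_{B(0,L)} Φ²`.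
* `stub_localLimitField` (S3b, M–L — `CLayerWitnessLocalLimit.stub_localLimit` + silence of the limit).
* `stub_layerUnfolding`  (S5a, L — torus-section unfolding of a silent Barlow stacking).
* `stub_rodProfile`      (S5b, M — continuity and `(1+|t|)⁻²` decay of `rodProfile a K`).
* `stub_rodSlice`        (S5c, M — Fourier slice `𝓕₁ (rodProfile a K) = 𝓕₃ K̃ ∘ rodPoint a`).
* `stub_rodLemma`        (S5d, L — the 1-D spectral lemma, lead's stub).
Proved in tree and used directly: trial-state bound (`ExcessDecayLiouvilleCoarseGrains.stub_trialBound`,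
= item 11963), thinning (`CLayerWitnessThinning.stub_thinning`), layering on the window
(`CLayerWitnessReduction.layering_of_exact_stars`), alternating word ⇒ hcp
(`CLayerWitnessWitness.eq_mul_alternatingHagg`, `barlowStacking_neg_alternating`).

Disproof.lean (cdisprove, NO KILL) honoured: energy enters only S3a (`not_rigidForWithoutEnergy`), the
isometry is PRODUCED by layering + S5 (`not_rigidForWithoutRotations`), the witness is
`hcpPeriodicConfiguration a h` through `0`, vertex-transitive (`zero_mem_points_of_rigidFor`,
`rigidFor_vertexTransitive`), `RigidFor` is claimed for ONE `P` (`not_forall_rigidFor`).  Negatives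
3506 / 4146: every counting / matching statement is over `1/3`-SEPARATED sets, nothing tolerant is
asserted at `η > 0`.
-/

noncomputable section

open scoped BigOperators Topology FourierTransform
open MeasureTheory Filter Set Metric
open Literature.MathematicalPhysics.StatisticalMechanics
open Summit.AtomisticToContinuum.Crystallization.Theses.ThreeConeCertificate
  (SlackRigidity ExactCertificate)
open Summit.AtomisticToContinuum.Crystallization.Theorems.SlackRigidityNegative
  (E3 Good badCount BadFractionVanishes ExcessVanishes RigidFor slackRigidity_iff)
open Summit.AtomisticToContinuum.Crystallization.Theorems.SignedRootSilentField
  (E2 rodDual rodPoint rodProfile rodPhase norm_rodPoint_sq)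
open Summit.AtomisticToContinuum.Crystallization.Theorems

namespace Summit.AtomisticToContinuum.Crystallization.Cruxes.SlackRigidity.SignedRootSilentField

/-! ### The seven registered stubs (the ONLY `sorry`s of the file; statements expanded, tree vocabulary only) -/

/-- **STUB 1 (`stub_certificate`, XL — the LOCALISED EXACT CERTIFICATE, the transfer `C⁺`, OPEN).**
Data `(a, h, ρ, c, ρ', C_K, g, U, f, K, F)` with, in order:
1. window `0.775 a < h < 0.894 a` (the layering window of `CLayerWitnessReduction.layering_of_exact_stars`;
   ideal `h/a = √(2/3) ≈ 0.8165`);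
2. `V_LJ = g + U + f` on `(0,∞)`; `U ≥ 0` there; `U` continuous on `(0,∞)`; `g ≡ 0` on `[ρ, ∞)`;
3. SMEARING: `f = K ⋆ K` is the convolution square of a continuous radial kernel with
   `|K(r)| ≤ C_K (1+r)⁻⁴` (the signed root `𝓕K̃ = ±√f̂`; implies positive type, `posType_of_smear`):
   products integrable, `f(|u − v|) = ∫ K(|y−u|) K(|y−v|) dy`, `K` continuous, the decay bound;
4. star functional: `F ≥ 0`; `Σ_i F(star_i) ≤ Σ_{i<j} g + cN` on injective configurations (one-centre
   form of `c`-stability); `F` uniformly continuous in the local matching topology on `1/3`-separated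
   rooted sets;
5. exactness `c + f(0)/2 = −e(hcpPeriodicConfiguration a h)`;
6. WEAK TIGHT LOCUS read at radius `6a/5 ≤ ρ'`: a `1/3`-separated rooted set whose `ρ'`-star is `F`-tight
   and whose star pairs are `U`-tight has the exact linearly rotated Barlow `6a/5`-star of SOME Hägg word
   (h- and c-environments both allowed: `g`, `U` may be stacking-blind);
7. SELECTION CLAUSE (replaces the planner's `RodStrict`): `𝓕₃ (K ∘ |·|)` is non-zero, and `C²`, on the
   open spherical shell `4/(3a²) + 1/(4h²) < |ξ|² < 4/(3a²) + 1/h²` — the shell swept by the `(10)` rod at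
   heights `hξ₃ ∈ (1/2, 1)`, which contains NO hcp Bragg sphere for `16h²/(3a²) ∈ (2, 12)`; for a design
   with `f̂ = (𝓕K̃)²` smooth off the origin it says `f̂ > 0` there.
It implies crux 11959 `ExactCertificate` (`certificate_implies_exactCertificate` below).  Why plausibly
true: exactness of a Cohn–Kumar-type LP dual forces all three slacks to vanish at the relaxed hcp (hcp
stars ARE tight, hcp distances ARE zeros of `U`, hcp IS silent); its `f̂ ≥ 0` has `a₂|ξ|² + …` at the
origin (so the signed root is continuous `O(r⁻⁴)`) and is generically positive strictly between the
consecutive forced Bragg spheres `(101)`, `(102)`.  Why it might fail: as 11959 (triple complementary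
slackness at finite `ρ`; finite-range crystallisation of `g`), plus a tight frustrated `1/3`-separated
star of the LP's `F`.  Sources: CohnKumar2006 §9, CohnEtAl2019, BlancLewin2015 §2, Ehm–Gneiting–Richards
2004 (convolution roots of radial positive definite functions). -/
theorem stub_certificate :
    ∃ (a h : ℝ) (ha : 0 < a) (hh : 0 < h), 0.775 * a < h ∧ h < 0.894 * a ∧
    ∃ (ρ c ρ' CK : ℝ) (g U f K : ℝ → ℝ) (F : Set E3 → ℝ),
      (∀ r : ℝ, 0 < r → lennardJones r = g r + U r + f r) ∧
      (∀ r : ℝ, 0 < r → 0 ≤ U r) ∧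
      ContinuousOn U (Set.Ioi 0) ∧
      (∀ r : ℝ, ρ ≤ r → g r = 0) ∧
      (∀ u v : E3, Integrable (fun y : E3 => K ‖y - u‖ * K ‖y - v‖)) ∧
      (∀ u v : E3, f (dist u v) = ∫ y : E3, K ‖y - u‖ * K ‖y - v‖) ∧
      Continuous K ∧
      (∀ r : ℝ, 0 ≤ r → |K r| ≤ CK / (1 + r) ^ 4) ∧
      (∀ T : Set E3, 0 ≤ F T) ∧
      (∀ (N : ℕ) (x : Fin N → E3), Function.Injective x →
        ∑ i, F (((fun z => z - x i) '' Set.range x) ∩ Metric.closedBall 0 ρ') ≤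
          interactionEnergy g x + c * N) ∧
      (∀ ε : ℝ, 0 < ε → ∃ η : ℝ, 0 < η ∧ ∀ S T : Set E3,
        (∀ p ∈ S, ∀ q ∈ S, p ≠ q → (1 / 3 : ℝ) ≤ dist p q) →
        (∀ p ∈ T, ∀ q ∈ T, p ≠ q → (1 / 3 : ℝ) ≤ dist p q) →
        (0 : E3) ∈ S → (0 : E3) ∈ T → BallMatch η (ρ' + 1) 0 S T →
        |F (S ∩ Metric.closedBall 0 ρ') - F (T ∩ Metric.closedBall 0 ρ')| ≤ ε) ∧
      c + f 0 / 2 = -((hcpPeriodicConfiguration ha.ne' hh.ne').energyPerParticle lennardJones) ∧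
      (∀ T : Set E3, (∀ p ∈ T, ∀ q ∈ T, p ≠ q → (1 / 3 : ℝ) ≤ dist p q) → (0 : E3) ∈ T →
        F (T ∩ Metric.closedBall 0 ρ') = 0 →
        (∀ p ∈ T, ∀ q ∈ T, ‖p‖ ≤ ρ' → ‖q‖ ≤ ρ' → p ≠ q → U (dist p q) = 0) →
        ∃ s : ℤ → ℤ, IsHaggSeq s ∧ ∃ B : E3 →ₗᵢ[ℝ] E3,
          T ∩ Metric.closedBall 0 (6 * a / 5) =
            B '' (barlowStacking a h s ∩ Metric.closedBall 0 (6 * a / 5))) ∧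
      (∀ v : E3, 4 / (3 * a ^ 2) + 1 / (4 * h ^ 2) < ‖v‖ ^ 2 →
        ‖v‖ ^ 2 < 4 / (3 * a ^ 2) + 1 / h ^ 2 → 𝓕 (fun y : E3 => (K ‖y‖ : ℂ)) v ≠ 0) ∧
      ContDiffOn ℝ 2 (𝓕 (fun y : E3 => (K ‖y‖ : ℂ)))
        {v : E3 | 4 / (3 * a ^ 2) + 1 / (4 * h ^ 2) < ‖v‖ ^ 2 ∧ ‖v‖ ^ 2 < 4 / (3 * a ^ 2) + 1 / h ^ 2} := by
  sorry

/-- **STUB 3a (`stub_rootingField`, M — ROOTING WITH THE FIELD CHANNEL; LANDED p118629 as `SignedRootRooting.stub_rootingField`).**  The landed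
`CLayerWitnessRooting.stub_rooting` with the positive-type hypothesis on `f` replaced by the smearing
representation `f = K ⋆ K`, and ONE MORE conclusion: along the rooted bad sequence `S_k ∋ 0` (finite,
`1/3`-separated, not root-matched at `(R, ε)`, vanishing local `(F,U)`-slack) the local `L²`-mass of the
smeared field at the root vanishes, `∫_{B(0,L)} (Σ_{q ∈ S_k} K(|y − q|))² dy → 0` for every `L`.
Why true: the total slack of the thinned configuration `z` is
`Σ_i F_i + Σ_{i<j} U + ½∫Φ_z² ≤ E(z) + (c + f(0)/2)·M` (smearing identity with unit weights:
`Σ_{i,j} f(r_ij) = ∫Φ_z²`), still `o(N)`; the per-root field weight `∫_{B(z_i,L)} Φ_z²` has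
`Σ_i ∫_{B(z_i,L)} Φ_z² ≤ (6L+1)³ ∫Φ_z²` by the packing count `card_filter_dist_le`; Markov as in
`exists_bad_localSlack_le`, diagonal in `(L, η)` as in `stub_rooting`. [folklore] -/
theorem stub_rootingField :
  (∃ K : ℝ, 0 < K ∧ ∀ (N : ℕ) (x : Fin N → E3), Function.Injective x →
    ∃ (M : ℕ) (y : Fin M → E3), Function.Injective y ∧ Set.range y ⊆ Set.range x ∧
      (∀ i j : Fin M, i ≠ j → (1 / 3 : ℝ) ≤ dist (y i) (y j)) ∧ M ≤ N ∧
      K * ((N : ℝ) - M) ≤ interactionEnergy lennardJones x - groundStateEnergy lennardJones 3 N ∧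
      interactionEnergy lennardJones y ≤ interactionEnergy lennardJones x) →
  ∀ (P : PeriodicConfiguration 3) (c ρ' : ℝ) (g U f K : ℝ → ℝ) (F : Set E3 → ℝ),
    (∀ r : ℝ, 0 < r → lennardJones r = g r + U r + f r) →
    (∀ r : ℝ, 0 < r → 0 ≤ U r) →
    (∀ u v : E3, Integrable (fun y : E3 => K ‖y - u‖ * K ‖y - v‖)) →
    (∀ u v : E3, f (dist u v) = ∫ y : E3, K ‖y - u‖ * K ‖y - v‖) →
    Continuous K →
    (∀ T : Set E3, 0 ≤ F T) →
    (∀ (N : ℕ) (x : Fin N → E3), Function.Injective x →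
      ∑ i, F (((fun z => z - x i) '' Set.range x) ∩ Metric.closedBall 0 ρ') ≤
        interactionEnergy g x + c * N) →
    c + f 0 / 2 = -(P.energyPerParticle lennardJones) →
    (∀ η : ℝ, 0 < η → ∃ N₀ : ℕ, ∀ N : ℕ, N₀ ≤ N →
      groundStateEnergy lennardJones 3 N ≤ (N : ℝ) * (P.energyPerParticle lennardJones + η)) →
    ¬ RigidFor P →
    ∃ (R ε : ℝ), 0 < R ∧ 0 < ε ∧ ∃ S : ℕ → Set E3,
      (∀ k, (S k).Finite) ∧
      (∀ k, ∀ p ∈ S k, ∀ q ∈ S k, p ≠ q → (1 / 3 : ℝ) ≤ dist p q) ∧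
      (∀ k, (0 : E3) ∈ S k) ∧
      (∀ k, ¬ ∃ A : E3 →ₗᵢ[ℝ] E3,
        (∀ p ∈ P.points, ‖p‖ ≤ R → ∃ q ∈ S k, dist q (A p) ≤ ε) ∧
        (∀ q ∈ S k, ‖q‖ ≤ R → ∃ p ∈ P.points, dist q (A p) ≤ ε)) ∧
      (∀ L η : ℝ, 0 < η → ∀ᶠ k in Filter.atTop, ∀ s ∈ S k, ‖s‖ ≤ L →
        F (((fun z => z - s) '' S k) ∩ Metric.closedBall 0 ρ') ≤ η ∧
        ∀ s' ∈ S k, s' ≠ s → ‖s'‖ ≤ L → U (dist s s') ≤ η) ∧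
      (∀ L η : ℝ, 0 < η → ∀ᶠ k in Filter.atTop,
        ∫ y in Metric.closedBall (0 : E3) L, (∑' q : ↥(S k), K ‖y - (q : E3)‖) ^ 2 ≤ η) :=
  SignedRootRooting.stub_rootingField

/-- **STUB 3b (`stub_localLimitField`, M–L — THE LOCAL LIMIT IS ZERO-SLACK, SILENT AND UNMATCHED; LANDED p118662 as `SignedRootLocalLimit.stub_localLimitField`).**
The landed `CLayerWitnessLocalLimit.stub_localLimit` with two more hypotheses (a continuous kernel
`|K(r)| ≤ C_K(1+r)⁻⁴`; vanishing local field mass along the finite rooted sets `S_k`) and ONE MORE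
conclusion: the local limit `Y` is SILENT, `Σ_{q ∈ Y} K(|y − q|) = 0` (as a `HasSum`) at every `y ∈ ℝ³`.
Why true: along the convergent subsequence (`exists_subseq_forall_eventually_ballMatch`, `δ = 1/3`) the
fields `Φ_{S_k}` converge to `Φ_Y` locally uniformly (continuity of `K`, the `(1+r)⁻⁴` tail is summable
over `1/3`-separated sets uniformly, `card ≤ (6r+1)³` in balls), so `∫_{B(0,L)} Φ_Y² ≤ liminf = 0` for
every `L`, `Φ_Y` is continuous, hence `Φ_Y ≡ 0` (equivalently: test `Φ_{S_k}` against `φ ∈ C_c`,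
Cauchy–Schwarz, and pass the absolutely convergent sums `Σ_q (K̃ ⋆ φ)(q)` to the limit). [folklore] -/
theorem stub_localLimitField :
  ∀ (P : PeriodicConfiguration 3) (ρ' R ε CK : ℝ) (U K : ℝ → ℝ) (F : Set E3 → ℝ) (S : ℕ → Set E3),
    0 < ε →
    (∀ r : ℝ, 0 < r → 0 ≤ U r) → ContinuousOn U (Set.Ioi 0) → (∀ T : Set E3, 0 ≤ F T) →
    (∀ ε' : ℝ, 0 < ε' → ∃ η : ℝ, 0 < η ∧ ∀ S' T : Set E3,
      (∀ p ∈ S', ∀ q ∈ S', p ≠ q → (1 / 3 : ℝ) ≤ dist p q) →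
      (∀ p ∈ T, ∀ q ∈ T, p ≠ q → (1 / 3 : ℝ) ≤ dist p q) →
      (0 : E3) ∈ S' → (0 : E3) ∈ T → BallMatch η (ρ' + 1) 0 S' T →
      |F (S' ∩ Metric.closedBall 0 ρ') - F (T ∩ Metric.closedBall 0 ρ')| ≤ ε') →
    Continuous K → (∀ r : ℝ, 0 ≤ r → |K r| ≤ CK / (1 + r) ^ 4) →
    (∀ k, (S k).Finite) →
    (∀ k, ∀ p ∈ S k, ∀ q ∈ S k, p ≠ q → (1 / 3 : ℝ) ≤ dist p q) →
    (∀ k, (0 : E3) ∈ S k) →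
    (∀ k, ¬ ∃ A : E3 →ₗᵢ[ℝ] E3,
      (∀ p ∈ P.points, ‖p‖ ≤ R → ∃ q ∈ S k, dist q (A p) ≤ ε) ∧
      (∀ q ∈ S k, ‖q‖ ≤ R → ∃ p ∈ P.points, dist q (A p) ≤ ε)) →
    (∀ L η : ℝ, 0 < η → ∀ᶠ k in Filter.atTop, ∀ s ∈ S k, ‖s‖ ≤ L →
      F (((fun z => z - s) '' S k) ∩ Metric.closedBall 0 ρ') ≤ η ∧
      ∀ s' ∈ S k, s' ≠ s → ‖s'‖ ≤ L → U (dist s s') ≤ η) →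
    (∀ L η : ℝ, 0 < η → ∀ᶠ k in Filter.atTop,
      ∫ y in Metric.closedBall (0 : E3) L, (∑' q : ↥(S k), K ‖y - (q : E3)‖) ^ 2 ≤ η) →
    ∃ Y : Set E3,
      (∀ p ∈ Y, ∀ q ∈ Y, p ≠ q → (1 / 3 : ℝ) ≤ dist p q) ∧ (0 : E3) ∈ Y ∧
      (∀ y ∈ Y, F (((fun z => z - y) '' Y) ∩ Metric.closedBall 0 ρ') = 0) ∧
      (∀ y ∈ Y, ∀ y' ∈ Y, y ≠ y' → U (dist y y') = 0) ∧
      (∀ y : E3, HasSum (fun q : ↥Y => K ‖y - (q : E3)‖) 0) ∧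
      ¬ ∃ A : E3 →ₗᵢ[ℝ] E3,
        (∀ p ∈ P.points, ‖p‖ ≤ R + 1 → ∃ q ∈ Y, dist q (A p) ≤ ε / 2) ∧
        (∀ q ∈ Y, ‖q‖ ≤ R + 1 → ∃ p ∈ P.points, dist q (A p) ≤ ε / 2) :=
  SignedRootLocalLimit.stub_localLimitField

/-- **STUB 5a (`stub_layerUnfolding`, L — TORUS-SECTION UNFOLDING OF A SILENT BARLOW STACKING; LANDED p118762 as `SignedRootUnfolding.stub_layerUnfolding`).**
If the Barlow stacking `barlowStacking a h s` (`a, h > 0`, any `s`) is silent for a continuous kernel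
`|K(r)| ≤ C_K(1+r)⁻⁴`, then for every height `t` the layer phases `ω^{L_k} = rodPhase s k` and the rod
profile `c_G = rodProfile a K` satisfy the 1-D identity `Σ_k ω^{L_k} c_G(t − kh) = 0`.
Why true: parametrise the stacking by `(k, i, j) ↦ barlowPos a h s k i j` (injective); on the section
`y = (u, t)`, `u ∈ ℝ²`, integrate the silent field against `e^{−2πi⟨u, G⟩}` over a fundamental
parallelogram of the layer lattice `Λ = ℤ(a,0) + ℤ(a/2, a√3/2)` (absolute convergence from the decay:
`Σ_k ∫_{ℝ²} (1+√(|u|²+(t−kh)²))⁻⁴ du < ∞`); layer `k` unfolds (`ZSpan.isAddFundamentalDomain`,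
`IsAddFundamentalDomain.integral_eq_tsum`) to `∫_{ℝ²} K(√(|u − L_k w|² + (t−kh)²)) e^{−2πi⟨u,G⟩} du
= e^{−2πi L_k⟨w,G⟩} c_G(t − kh)` with `⟨(a,0),G⟩ = 1`, `⟨(a/2,a√3/2),G⟩ = 0`, `⟨w,G⟩ = 1/3`.
[folklore] -/
theorem stub_layerUnfolding :
  ∀ (a h CK : ℝ), 0 < a → 0 < h → ∀ K : ℝ → ℝ, Continuous K →
    (∀ r : ℝ, 0 ≤ r → |K r| ≤ CK / (1 + r) ^ 4) →
    ∀ s : ℤ → ℤ,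
      (∀ y : E3, HasSum (fun q : ↥(barlowStacking a h s) => K ‖y - (q : E3)‖) 0) →
      ∀ t : ℝ, HasSum (fun k : ℤ => rodPhase s k * rodProfile a K (t - k * h)) 0 :=
  SignedRootUnfolding.stub_layerUnfolding

/-- **STUB 5b (`stub_rodProfile`, M — REGULARITY OF THE ROD PROFILE; LANDED p118002 as `SignedRootProfile.stub_rodProfile`).**  For a continuous kernel
`|K(r)| ≤ C_K(1+r)⁻⁴` the rod profile `t ↦ rodProfile a K t = ∫_{ℝ²} K(√(|u|²+t²)) e^{−2πi⟨u,G⟩} du`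
is continuous and `O((1+|t|)⁻²)`.  Why true: dominated convergence; for the decay substitute
`u = (1+|t|) u'` and use `1 + √((1+|t|)²|u'|² + t²) ≥ (1+|t|)(1+|u'|)/2`, `∫_{ℝ²} (1+|u'|)⁻⁴ du' < ∞`
(`integrable_one_add_norm`). [folklore] -/
theorem stub_rodProfile :
  ∀ (a CK : ℝ) (K : ℝ → ℝ), Continuous K → (∀ r : ℝ, 0 ≤ r → |K r| ≤ CK / (1 + r) ^ 4) →
    Continuous (rodProfile a K) ∧ ∃ C : ℝ, ∀ t : ℝ, ‖rodProfile a K t‖ ≤ C / (1 + |t|) ^ 2 :=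
  SignedRootProfile.stub_rodProfile

/-- **STUB 5c (`stub_rodSlice`, M — FOURIER SLICE ALONG THE ROD; LANDED p118157 as `SignedRootSlice.stub_rodSlice`).**  For a continuous kernel
`|K(r)| ≤ C_K(1+r)⁻⁴` (so `y ↦ K(|y|)` is integrable on `ℝ³`), the 1-D Fourier transform of the rod
profile is the 3-D Fourier transform of `y ↦ K(|y|)` restricted to the rod:
`𝓕₁ (rodProfile a K) ξ₃ = 𝓕₃ (K ∘ |·|) (rodPoint a ξ₃)`.  Why true: Fubini through the
volume-preserving identification `ℝ³ ≃ ℝ² × ℝ` (`EuclideanSpace.volume_preserving_measurableEquiv`,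
`volume_preserving_piFinSuccAbove`), `⟨(u, t), rodPoint a ξ₃⟩ = ⟨u, rodDual a⟩ + t ξ₃`. [folklore] -/
theorem stub_rodSlice :
  ∀ (a CK : ℝ) (K : ℝ → ℝ), Continuous K → (∀ r : ℝ, 0 ≤ r → |K r| ≤ CK / (1 + r) ^ 4) →
    ∀ ξ₃ : ℝ, 𝓕 (rodProfile a K) ξ₃ = 𝓕 (fun y : E3 => (K ‖y‖ : ℂ)) (rodPoint a ξ₃) :=
  SignedRootSlice.stub_rodSlice

/-- **STUB 5d (`stub_rodLemma`, L — THE 1-D SPECTRAL LEMMA, lead's stub; LANDED as `SignedRootRodLemma.stub_rodLemma`, files RodLemmaA–E + RodLemma).**  Let `h > 0`, `u : ℤ → ℂ`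
bounded, `c : ℝ → ℂ` continuous with `|c(t)| ≤ C(1+|t|)⁻²`, and suppose the 1-D Fourier transform
`𝓕c` is `C²` and zero-free on `(1/(2h), 1/h) ∪ (−1/h, −1/(2h))`.  If `Σ_k u_k c(t − kh) = 0` for every
real `t`, then `u` is `2`-periodic.  Why true (no Wiener division, no distributions): scale to `h = 1`;
for `φ ∈ C_c²` of a good interval `J`, test the identity against `ψ = 𝓕(φ/𝓕c)` (`∈ L¹` by two
integrations by parts) and use the multiplication formula `∫ c · 𝓕g = ∫ 𝓕c · g`
(`VectorFourier.integral_fourierIntegral_smul_eq_flip`): `Σ_k u_k 𝓕φ(k) = 0`; integer translates of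
`J` cover `ℝ ∖ ½ℤ`; a bump-shrinking estimate (`Σ_k |𝓕φ(k)| ≤ ‖φ‖₁ + ‖φ''‖₁`) extends the annihilation
to all `φ ∈ C_c²` with vanishing `2`-jets on `½ℤ`; evaluating on `Q₀ e^{2πik₀·}` with `𝓕Q₀|_ℤ = δ₀`
(`Q₀ = S(·+½) − S(·−½)`, `S` a smooth step) gives `u_{k₀} = P(k₀) + (−1)^{k₀} R(k₀)` with `deg ≤ 2`;
boundedness forces `2`-periodicity.  Sources: Rudin, *Functional Analysis* Thm 9.3 (the statement
being replaced), Katznelson VI (spectral synthesis at finite sets). [folklore] -/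
theorem stub_rodLemma :
  ∀ (h : ℝ), 0 < h → ∀ (u : ℤ → ℂ) (c : ℝ → ℂ), (∃ M : ℝ, ∀ k, ‖u k‖ ≤ M) → Continuous c →
    (∃ C : ℝ, ∀ t : ℝ, ‖c t‖ ≤ C / (1 + |t|) ^ 2) →
    ContDiffOn ℝ 2 (𝓕 c) (Set.Ioo (1 / (2 * h)) (1 / h) ∪ Set.Ioo (-(1 / h)) (-(1 / (2 * h)))) →
    (∀ ξ ∈ Set.Ioo (1 / (2 * h)) (1 / h) ∪ Set.Ioo (-(1 / h)) (-(1 / (2 * h))), 𝓕 c ξ ≠ 0) →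
    (∀ t : ℝ, HasSum (fun k : ℤ => u k * c (t - k * h)) 0) →
    ∀ k : ℤ, u (k + 2) = u k :=
  SignedRootRodLemma.stub_rodLemma

/-! ### Glue lemmas (sorry-free) -/

/-- **Silence is transported by a linear isometry**: if `A '' S` is silent then `S` is silent
(`K` enters only through distances). [folklore] -/
theorem silent_of_silent_image {K : ℝ → ℝ} {S : Set E3} (A : E3 →ₗᵢ[ℝ] E3)
    (hsil : ∀ y : E3, HasSum (fun q : ↥(A '' S) => K ‖y - (q : E3)‖) 0) :
    ∀ y : E3, HasSum (fun p : ↥S => K ‖y - (p : E3)‖) 0 := by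
  intro y
  have h := hsil (A y)
  set e : ↥S ≃ ↥(A '' S) := Equiv.Set.image A S A.injective with he
  rw [← e.hasSum_iff] at h
  convert h using 1
  funext p
  simp only [Function.comp_apply]
  have hp : ((e p : ↥(A '' S)) : E3) = A (p : E3) := rfl
  rw [hp, ← map_sub, LinearIsometry.norm_map]

/-- **Two-periodic layer phases ⇒ alternating Hägg word**: `ω^{L_{k+2}} = ω^{L_k}` with `ω` a primitive
cube root of unity forces `3 ∣ s k + s (k+1)`, hence `s (k+1) = −s k` for a `±1` word. [folklore] -/
theorem succ_eq_neg_of_rodPhase_periodic {s : ℤ → ℤ} (hs : IsHaggSeq s)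
    (hper : ∀ k : ℤ, rodPhase s (k + 2) = rodPhase s k) (m : ℤ) : s (m + 1) = -s m := by
  have h := hper m
  rw [rodPhase, rodPhase, Complex.exp_eq_exp_iff_exists_int] at h
  obtain ⟨n, hn⟩ := h
  have hL : haggLabel s (m + 2) = haggLabel s m + s m + s (m + 1) := by
    rw [show m + 2 = m + 1 + 1 by ring, haggLabel_succ, haggLabel_succ]
  have hπ : (2 * (Real.pi : ℂ) * Complex.I) ≠ 0 := by
    have : (Real.pi : ℂ) ≠ 0 := by exact_mod_cast Real.pi_ne_zero
    simp [this, Complex.I_ne_zero]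
  -- from `−2πi L_{m+2}/3 = −2πi L_m/3 + n·2πi`: `L_{m+2} − L_m = −3n`
  have hdiv : ((haggLabel s (m + 2) : ℤ) : ℂ) - (haggLabel s m : ℂ) = -3 * (n : ℂ) := by
    have key : (2 * (Real.pi : ℂ) * Complex.I) *
        ((haggLabel s (m + 2) : ℂ) - (haggLabel s m : ℂ) + 3 * n) = 0 := by
      linear_combination (-3 : ℂ) * hn
    rcases mul_eq_zero.1 key with h0 | h0
    · exact absurd h0 hπ
    · linear_combination h0
  have hint : s m + s (m + 1) = -3 * n := by
    have h1 : ((s m + s (m + 1) : ℤ) : ℂ) = ((-3 * n : ℤ) : ℂ) := by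
      push_cast
      rw [← hdiv, hL]
      push_cast
      ring
    exact_mod_cast h1
  rcases hs m with h0 | h0 <;> rcases hs (m + 1) with h1 | h1 <;> omega

/-- **Alternating word ⇒ rotated hcp** (landed c-layer algebra): if `s (m+1) = −s m` for all `m` then
`barlowStacking a h s` is `hcpStacking a h` up to a linear isometry (identity or half-turn). [folklore] -/
theorem exists_eq_image_hcp_of_alternating (a h : ℝ) {s : ℤ → ℤ} (hs : IsHaggSeq s)
    (halt : ∀ m, s (m + 1) = -s m) :
    ∃ B : E3 →ₗᵢ[ℝ] E3, barlowStacking a h s = B '' hcpStacking a h := by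
  have hmul : ∀ m, s m = s 0 * alternatingHagg m := CLayerWitnessWitness.eq_mul_alternatingHagg halt
  rcases hs 0 with h0 | h0
  · obtain rfl : s = alternatingHagg := funext fun m => by rw [hmul, h0, one_mul]
    exact ⟨LinearIsometry.id, by simp [hcpStacking]⟩
  · obtain rfl : s = fun m => -alternatingHagg m := funext fun m => by rw [hmul, h0]; ring
    exact ⟨halfTurn.toLinearIsometry, CLayerWitnessWitness.barlowStacking_neg_alternating a h⟩

/-- The rod `ξ₃ ↦ rodPoint a ξ₃` is an affine line: `rodPoint a ξ₃ = rodPoint a 0 + ξ₃ • e₃`. [folklore] -/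
theorem rodPoint_eq_add_smul (a ξ₃ : ℝ) :
    rodPoint a ξ₃ = rodPoint a 0 + ξ₃ • EuclideanSpace.single (2 : Fin 3) (1 : ℝ) := by
  ext i
  fin_cases i <;> simp [rodPoint]

/-- The rod is a smooth curve. [folklore] -/
theorem contDiff_rodPoint (a : ℝ) : ContDiff ℝ 2 (fun ξ₃ : ℝ => rodPoint a ξ₃) := by
  have : (fun ξ₃ : ℝ => rodPoint a ξ₃) =
      fun ξ₃ : ℝ => rodPoint a 0 + ξ₃ • EuclideanSpace.single (2 : Fin 3) (1 : ℝ) :=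
    funext fun ξ₃ => rodPoint_eq_add_smul a ξ₃
  rw [this]
  exact contDiff_const.add (contDiff_id.smul contDiff_const)

/-- **The selection clause read on the rod.**  Under clauses 7 of the certificate and the Fourier slice,
`𝓕 (rodProfile a K)` is `C²` and zero-free on `(1/(2h), 1/h) ∪ (−1/h, −1/(2h))`. [folklore] -/
theorem rod_hypotheses {a h : ℝ} (ha : 0 < a) (hh : 0 < h) {K : ℝ → ℝ}
    (hnv : ∀ v : E3, 4 / (3 * a ^ 2) + 1 / (4 * h ^ 2) < ‖v‖ ^ 2 →
      ‖v‖ ^ 2 < 4 / (3 * a ^ 2) + 1 / h ^ 2 → 𝓕 (fun y : E3 => (K ‖y‖ : ℂ)) v ≠ 0)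
    (hsm : ContDiffOn ℝ 2 (𝓕 (fun y : E3 => (K ‖y‖ : ℂ)))
      {v : E3 | 4 / (3 * a ^ 2) + 1 / (4 * h ^ 2) < ‖v‖ ^ 2 ∧ ‖v‖ ^ 2 < 4 / (3 * a ^ 2) + 1 / h ^ 2})
    (hslice : ∀ ξ₃ : ℝ, 𝓕 (rodProfile a K) ξ₃ = 𝓕 (fun y : E3 => (K ‖y‖ : ℂ)) (rodPoint a ξ₃)) :
    ContDiffOn ℝ 2 (𝓕 (rodProfile a K))
        (Set.Ioo (1 / (2 * h)) (1 / h) ∪ Set.Ioo (-(1 / h)) (-(1 / (2 * h)))) ∧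
      ∀ ξ ∈ Set.Ioo (1 / (2 * h)) (1 / h) ∪ Set.Ioo (-(1 / h)) (-(1 / (2 * h))),
        𝓕 (rodProfile a K) ξ ≠ 0 := by
  -- heights of the good intervals square into `(1/(4h²), 1/h²)`
  have hsq : ∀ ξ ∈ Set.Ioo (1 / (2 * h)) (1 / h) ∪ Set.Ioo (-(1 / h)) (-(1 / (2 * h))),
      1 / (4 * h ^ 2) < ξ ^ 2 ∧ ξ ^ 2 < 1 / h ^ 2 := by
    intro ξ hξ
    have e1 : (1 / (2 * h)) ^ 2 = 1 / (4 * h ^ 2) := by field_simp; ring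
    have e2 : (1 / h) ^ 2 = 1 / h ^ 2 := by rw [one_div, inv_pow, one_div]
    have hpos : 0 < 1 / (2 * h) := by positivity
    rcases hξ with ⟨h1, h2⟩ | ⟨h1, h2⟩
    · have hξ0 : 0 < ξ := hpos.trans h1
      refine ⟨?_, ?_⟩
      · rw [← e1]; exact pow_lt_pow_left₀ h1 hpos.le two_ne_zero
      · rw [← e2]; exact pow_lt_pow_left₀ h2 hξ0.le two_ne_zero
    · have hξ0 : 0 < -ξ := by linarith
      refine ⟨?_, ?_⟩
      · rw [← e1, ← neg_sq ξ]; exact pow_lt_pow_left₀ (by linarith) hpos.le two_ne_zero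
      · rw [← e2, ← neg_sq ξ]; exact pow_lt_pow_left₀ (by linarith) hξ0.le two_ne_zero
  have hmem : ∀ ξ ∈ Set.Ioo (1 / (2 * h)) (1 / h) ∪ Set.Ioo (-(1 / h)) (-(1 / (2 * h))),
      rodPoint a ξ ∈ {v : E3 | 4 / (3 * a ^ 2) + 1 / (4 * h ^ 2) < ‖v‖ ^ 2 ∧
        ‖v‖ ^ 2 < 4 / (3 * a ^ 2) + 1 / h ^ 2} := by
    intro ξ hξ
    obtain ⟨h1, h2⟩ := hsq ξ hξ
    simp only [Set.mem_setOf_eq, norm_rodPoint_sq ha.ne']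
    exact ⟨by linarith, by linarith⟩
  have hfun : 𝓕 (rodProfile a K) = fun ξ₃ => 𝓕 (fun y : E3 => (K ‖y‖ : ℂ)) (rodPoint a ξ₃) :=
    funext hslice
  refine ⟨?_, fun ξ hξ => ?_⟩
  · rw [hfun]
    exact hsm.comp (contDiff_rodPoint a).contDiffOn fun ξ hξ => hmem ξ hξ
  · rw [hslice]
    have := hmem ξ hξ
    exact hnv _ this.1 this.2

/-! ### The composition (kernel-checked, no `sorry`) -/

/-- **`SlackRigidity` from the seven stubs.**  Witness `P := hcpPeriodicConfiguration a h` of the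
certificate (S1).  If `RigidFor P` failed: thinning (landed) + rooting-with-field (S3a, fed by the landed
trial-state bound) give a rooted bad sequence of vanishing three-channel local slack; its local limit
(S3b) is a `1/3`-separated `Y ∋ 0`, `F`-tight, `U`-tight, SILENT and unmatched at `(R+1, ε/2)`; the weak
tight locus makes every `6a/5`-star of `Y` an exact rotated Barlow star, so the landed layering theorem
makes `Y = A '' barlowStacking a h s` (`A` linear); silence passes to the stacking
(`silent_of_silent_image`), unfolds on the torus sections (S5a) into `Σ_k ω^{L_k} c_G(t − kh) = 0`, and
the 1-D spectral lemma (S5d; its hypotheses on `c_G = rodProfile a K` are S5b and — through the Fourier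
slice S5c — the certificate's selection clause) makes `ω^{L_k}` two-periodic; so the word alternates,
the stacking is a rotated `hcpStacking a h`, and `Y` IS root-matched at every scale — contradiction. -/
theorem SlackRigidity_of : SlackRigidity := by
  classical
  obtain ⟨a, h, ha, hh, hw1, hw2, ρ, c, ρ', CK, g, U, f, K, F, hsplit, hU0, hUc, hg0, hsmi, hsm, hKc,
    hKd, hF0, hstar, hcont, hid, htight, hnv0, hsm0⟩ := stub_certificate
  rw [slackRigidity_iff]
  refine ⟨hcpPeriodicConfiguration ha.ne' hh.ne', ?_⟩
  by_contra hrig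
  -- S3a (fed by the landed thinning and trial-state bound): a rooted bad sequence, small in 3 channels
  obtain ⟨R, ε, hR, hε, S, hSfin, hsep, h0, hbad, hsmall, hfield⟩ :=
    stub_rootingField CLayerWitnessThinning.stub_thinning (hcpPeriodicConfiguration ha.ne' hh.ne') c ρ'
      g U f K F hsplit hU0 hsmi hsm hKc hF0 hstar hid
      (ExcessDecayLiouvilleCoarseGrains.stub_trialBound _) hrig
  -- S3b: a zero-slack, silent local limit, unmatched at the root
  obtain ⟨Y, hYsep, hY0, hYF, hYU, hYsil, hYbad⟩ :=
    stub_localLimitField (hcpPeriodicConfiguration ha.ne' hh.ne') ρ' R ε CK U K F S hε hU0 hUc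
      hF0 hcont hKc hKd hSfin hsep h0 hbad hsmall hfield
  -- weak tight locus: every `6a/5`-star of `Y` is an exact rotated Barlow star
  have hloc : ∀ y ∈ Y, ∃ s : ℤ → ℤ, IsHaggSeq s ∧ ∃ B : E3 →ₗᵢ[ℝ] E3,
      ((fun z => z - y) '' Y) ∩ Metric.closedBall 0 (6 * a / 5) =
        B '' (barlowStacking a h s ∩ Metric.closedBall 0 (6 * a / 5)) := by
    intro y hy
    refine htight ((fun z => z - y) '' Y) (CLayerWitnessReduction.separated_image_sub hYsep y) ⟨y, hy, sub_self y⟩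
      (hYF y hy) ?_
    rintro p ⟨p', hp', rfl⟩ q ⟨q', hq', rfl⟩ _ _ hpq
    have hne : p' ≠ q' := fun h => hpq (by rw [h])
    rw [dist_sub_right]
    exact hYU p' hp' q' hq' hne
  -- landed layering on the window: `Y` is one linearly rotated Barlow stacking
  obtain ⟨s, hs, A, hYeq⟩ :=
    CLayerWitnessReduction.layering_of_exact_stars a h ha hh hw1 hw2 Y hY0 hloc
  -- silence of the stacking itself, unfolded on the torus sections (S5a)
  have hsilS : ∀ y : E3, HasSum (fun p : ↥(barlowStacking a h s) => K ‖y - (p : E3)‖) 0 := by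
    apply silent_of_silent_image A
    rw [← hYeq]
    exact hYsil
  have hrod : ∀ t : ℝ, HasSum (fun k : ℤ => rodPhase s k * rodProfile a K (t - k * h)) 0 :=
    stub_layerUnfolding a h CK ha hh K hKc hKd s hsilS
  -- the 1-D spectral lemma (S5d) with S5b, S5c and the selection clause: the phases are 2-periodic
  obtain ⟨hcc, Cc, hdec⟩ := stub_rodProfile a CK K hKc hKd
  obtain ⟨hsmooth, hnv⟩ := rod_hypotheses ha hh hnv0 hsm0 (stub_rodSlice a CK K hKc hKd)
  have hper : ∀ k : ℤ, rodPhase s (k + 2) = rodPhase s k :=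
    stub_rodLemma h hh (rodPhase s) (rodProfile a K)
      ⟨1, fun k => (SignedRootSilentField.norm_rodPhase s k).le⟩ hcc ⟨Cc, hdec⟩ hsmooth hnv hrod
  -- hence the word alternates and the stacking is rotated hcp
  obtain ⟨B, hB⟩ := exists_eq_image_hcp_of_alternating a h hs (succ_eq_neg_of_rodPhase_periodic hs hper)
  -- so `Y = (A ∘ B) '' P.points` is matched at the root: contradiction
  apply hYbad
  refine ⟨A.comp B, ?_, ?_⟩
  · intro p hp _
    refine ⟨A (B p), ?_, ?_⟩
    · rw [hYeq]
      refine ⟨B p, ?_, rfl⟩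
      rw [hB]
      refine ⟨p, ?_, rfl⟩
      rwa [hcpPeriodicConfiguration_points] at hp
    · rw [LinearIsometry.coe_comp, Function.comp_apply, dist_self]
      exact (half_pos hε).le
  · intro q hq _
    rw [hYeq] at hq
    obtain ⟨x, hx, rfl⟩ := hq
    rw [hB] at hx
    obtain ⟨p, hp, rfl⟩ := hx
    refine ⟨p, ?_, ?_⟩
    · rw [hcpPeriodicConfiguration_points]; exact hp
    · rw [LinearIsometry.coe_comp, Function.comp_apply, dist_self]
      exact (half_pos hε).le

/-! ### Sanity: Statement 1 is crux 11959 strengthened (sorry-free) -/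

/-- The weighted smearing identity: for `f = K ⋆ K`,
`Σᵢ Σⱼ wᵢ wⱼ f(|yᵢ − yⱼ|) = ∫ (Σⱼ wⱼ K(|z − yⱼ|))² dz`. [folklore] -/
theorem smearing_identity {f K : ℝ → ℝ}
    (hint : ∀ u v : E3, Integrable (fun y : E3 => K ‖y - u‖ * K ‖y - v‖))
    (hfK : ∀ u v : E3, f (dist u v) = ∫ y : E3, K ‖y - u‖ * K ‖y - v‖) {n : ℕ} (y : Fin n → E3)
    (w : Fin n → ℝ) :
    ∑ i, ∑ j, w i * w j * f (dist (y i) (y j)) = ∫ z : E3, (∑ j, w j * K ‖z - y j‖) ^ 2 := by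
  classical
  have hterm : ∀ i j, Integrable (fun z : E3 => w i * w j * (K ‖z - y i‖ * K ‖z - y j‖)) :=
    fun i j => (hint (y i) (y j)).const_mul (w i * w j)
  symm
  calc ∫ z : E3, (∑ j, w j * K ‖z - y j‖) ^ 2
      = ∫ z : E3, ∑ i, ∑ j, w i * w j * (K ‖z - y i‖ * K ‖z - y j‖) := by
        congr 1
        funext z
        rw [sq, Finset.sum_mul_sum]
        refine Finset.sum_congr rfl fun i _ => Finset.sum_congr rfl fun j _ => ?_
        ring
    _ = ∑ i, ∫ z : E3, ∑ j, w i * w j * (K ‖z - y i‖ * K ‖z - y j‖) := by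
        rw [integral_finsetSum]
        intro i _
        exact integrable_finsetSum _ fun j _ => hterm i j
    _ = ∑ i, ∑ j, ∫ z : E3, w i * w j * (K ‖z - y i‖ * K ‖z - y j‖) := by
        refine Finset.sum_congr rfl fun i _ => ?_
        rw [integral_finsetSum]
        intro j _
        exact hterm i j
    _ = ∑ i, ∑ j, w i * w j * f (dist (y i) (y j)) := by
        refine Finset.sum_congr rfl fun i _ => Finset.sum_congr rfl fun j _ => ?_
        rw [integral_const_mul, hfK (y i) (y j)]

/-- A smearing representation implies the route's inlined positive-type clause. [folklore] -/
theorem posType_of_smear {f K : ℝ → ℝ}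
    (hint : ∀ u v : E3, Integrable (fun y : E3 => K ‖y - u‖ * K ‖y - v‖))
    (hfK : ∀ u v : E3, f (dist u v) = ∫ y : E3, K ‖y - u‖ * K ‖y - v‖) :
    ∀ (n : ℕ) (y : Fin n → E3) (w : Fin n → ℝ), 0 ≤ ∑ i, ∑ j, w i * w j * f (dist (y i) (y j)) := by
  intro n y w
  rw [smearing_identity hint hfK y w]
  exact integral_nonneg fun z => sq_nonneg _

/-- Star-form certification implies `c`-stability of `g` (`F ≥ 0`). [folklore] -/
theorem stable_of_certificate {c ρ' : ℝ} {g : ℝ → ℝ} {F : Set E3 → ℝ}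
    (hF0 : ∀ T : Set E3, 0 ≤ F T)
    (hstar : ∀ (N : ℕ) (x : Fin N → E3), Function.Injective x →
      ∑ i, F (((fun z => z - x i) '' Set.range x) ∩ Metric.closedBall 0 ρ') ≤
        interactionEnergy g x + c * N)
    (N : ℕ) (x : Fin N → E3) (hx : Function.Injective x) : -(c * (N : ℝ)) ≤ interactionEnergy g x := by
  have h1 := hstar N x hx
  have h2 : 0 ≤ ∑ i, F (((fun z => z - x i) '' Set.range x) ∩ Metric.closedBall 0 ρ') :=
    Finset.sum_nonneg fun i _ => hF0 _
  linarith

/-- **Stub 1 ⇒ `ExactCertificate` (crux 11959)**: the localised certificate is a genuine strengthening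
of the route's rank-3 crux (so `stub_certificate` carries 11959's difficulty plus the localisation /
selection constraints, and nothing of `SlackRigidity` itself). [folklore] -/
theorem certificate_implies_exactCertificate : ExactCertificate := by
  obtain ⟨a, h, ha, hh, -, -, ρ, c, ρ', CK, g, U, f, K, F, hsplit, hU0, -, hg0, hsmi, hsm, -,
    -, hF0, hstar, -, hid, -, -, -⟩ := stub_certificate
  exact ⟨hcpPeriodicConfiguration ha.ne' hh.ne', ρ, c, g, U, f, hsplit, hU0, hg0,
    posType_of_smear hsmi hsm, fun N x hx => stable_of_certificate hF0 hstar N x hx, hid⟩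

end Summit.AtomisticToContinuum.Crystallization.Cruxes.SlackRigidity.SignedRootSilentField

end
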